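import Summits.BirchSwinnertonDyer.BirchSwinnertonDyer.Theorems.CMKolyvaginAtInertTwoMinusPartDescentAtTwoPow
import HarnessLib

/-!
# Route `CMKolyvaginAtInertTwo`, crux `CMKolyvaginExactAtInertTwo` (stmt-BirchSwinnertonDyer-24277):
# the `τ`-PART DESCENT AT `p = 2`, LEVEL `2^M` (KERNEL-STATUS §5 "(L)": the `M₀ ≥ 1` τ-part) and
# the habitat forms — corollaries of the `(−ε)`-part descent (`…MinusPartDescentAtTwoPow`)

Seat `bsd-line-cmk2-p1` g7 (cell `bsd-print-cf2`); helper (`--supports stmt-BirchSwinnertonDyer-24277`).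
THEOREMS ONLY: no definition, no named fact, no `sorry`; no item is closed; BSD is not proved by this.

* `two_pow_smul_sub_conjAct_eq_zero_of_families_two_pow` — **the `τ`-part descent at level `2^M`**:
  with the hypotheses of `two_pow_smul_selmer_minus_eq_zero_of_families_two_pow` (`ρ̄_{E,2}` onto,
  `Δ_E < 0`, `Δ_E ∉ K²`, `y_K = P` Heegner of infinite order with `2^a y_K ∉ 2^M E(K)`, the Cartan-type
  `z`, ty2's data `PointSystemFamily` / `ReciprocityFamily` at `p = 2`) and `ε = ±1` the sign with
  `c y_K − ε y_K` torsion: **`2^{M−a}·(s − ε c_* s) = 0` for every `s ∈ Sel_{2^M}(E/K)`** — the class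
  `t = s − ε c_* s` is Selmer with `c_* t = −ε t`, so the `(−ε)`-part descent applies. For `M = 1`,
  `a = 0` this is one bit WEAKER than g6's `conjAct_eq_self_of_families_two` (`c_* s = s` exactly;
  at level `2` the bit is recovered because `−1 = 1`); for `M ≥ 2` it is new: with `a = M − 1 − M₀`,
  `2^{M₀+1}·(1 − ετ)·Sel_{2^M}(E/K) = 0`.
* `two_pow_smul_selmer_minus_eq_zero_of_families_of_cmInert_two_of_heegner`,
  `two_pow_smul_sub_conjAct_eq_zero_of_families_of_cmInert_two_of_heegner` — ON THE HABITAT H₂ of the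
  route (`HasCM`, `CMInert W 2`, `ρ̄₂` onto, `K` Heegner for `N_E`) the hypotheses `Δ_E < 0`
  (`KolyvaginEigenTwo.Δ_neg_of_cmInert_two`, p591040) and `Δ_E ∉ K²`
  (`KolyvaginImageTwo.not_isSquare_algebraMap_Δ_of_cmInert_two_of_heegner`, p596346) are automatic.
  What is NOT automatic and stays a hypothesis: the Cartan-type `z` (`hcomm`, CM theory on
  `E[2^∞]`, see `…RestrictionInjectiveAtTwoPow`) and the machine's two inputs at `2` (ty2's data).

HONEST FRAMING: as in `…MinusPartDescentAtTwoPow` — exponent statements on the `(−ε)`-part and on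
`(1 − ετ)Sel`; the `τ`-invariant order-`2` part and the exact ORDER of `Ш(E/K)[2^∞]` (the crux) are
not reached. References: [GrossLMS1991] Prop. 2.1, §§5, 10; [McCallumLMS1991] §5 Lemma 5.1, Thm. 5.4.
-/

-- single-conjunct summit: `Summit.BirchSwinnertonDyer.BirchSwinnertonDyer.…` repeats the name by design
set_option linter.dupNamespace false
set_option autoImplicit false

noncomputable section

open scoped Classical
open WeierstrassCurve NumberField IsDedekindDomain Field
open Literature.NumberTheory.GaloisRepresentations Literature.NumberTheory.EllipticCurves

namespace Summit.BirchSwinnertonDyer.BirchSwinnertonDyer.Theorems.KolyvaginDescentTwo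

variable (W : WeierstrassCurve ℚ) {K : Type} [Field K] [NumberField K]

/-- If `c P − ε P` is torsion and `P` is not, then `c P + ε P = c P − (−ε) P` is not torsion
(`ε = ±1`). [folklore] -/
theorem not_isOfFinAddOrder_map_sub_neg_smul [W.IsElliptic] {P : (W.baseChange K).toAffine.Point}
    (hnt : ¬ IsOfFinAddOrder P) (c : K ≃ₐ[ℚ] K) {ε : ℤ} (hε : ε = 1 ∨ ε = -1)
    (h : IsOfFinAddOrder (Affine.Point.map (W' := W) (c : K →ₐ[ℚ] K) P - ε • P)) :
    ¬ IsOfFinAddOrder (Affine.Point.map (W' := W) (c : K →ₐ[ℚ] K) P - (-ε) • P) := by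
  intro h'
  apply hnt
  -- the difference of the two torsion points is `2ε P`
  have e : (Affine.Point.map (W' := W) (c : K →ₐ[ℚ] K) P - (-ε) • P) +
      -(Affine.Point.map (W' := W) (c : K →ₐ[ℚ] K) P - ε • P) = (2 * ε) • P := by
    rw [neg_zsmul, sub_neg_eq_add, ← smul_smul, two_zsmul]; abel
  have hdiff : IsOfFinAddOrder ((2 * ε) • P) := by
    rw [← e]; exact IsOfFinAddOrder.add h' (IsOfFinAddOrder.neg h)
  obtain ⟨n, hn, hnP⟩ := (isOfFinAddOrder_iff_nsmul_eq_zero).mp hdiff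
  refine (isOfFinAddOrder_iff_zsmul_eq_zero).mpr ⟨(n : ℤ) * (2 * ε), ?_, ?_⟩
  · exact mul_ne_zero (by exact_mod_cast hn.ne') (by rcases hε with rfl | rfl <;> norm_num)
  · rw [← smul_smul, natCast_zsmul, hnP]

/-- **The `τ`-part descent at `p = 2`, level `2^M` (ty2's data, full support):
`2^{M−a}·(s − ε c_* s) = 0` on `Sel_{2^M}(E/K)`** when `2^a y_K ∉ 2^M E(K)`, `ε` the sign of `y_K`
(`c y_K − ε y_K` torsion, `y_K` of infinite order); see the module docstring.
[cite: GrossLMS1991, Prop. 2.1 with §10 (proof), §5 (5.2)] [cite: McCallumLMS1991, §5 Lemma 5.1] -/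
theorem two_pow_smul_sub_conjAct_eq_zero_of_families_two_pow {N : ℕ} [NeZero N] [W.IsElliptic]
    (hK : IsImaginaryQuadratic K) {P : (W.baseChange K).toAffine.Point} (hP : IsHeegnerPoint N W K P)
    (hnt : ¬ IsOfFinAddOrder P)
    (hρ : W.HasSurjectiveModNGaloisRep 2) (hΔ : W.Δ < 0) (hΔK : ¬ IsSquare (W.baseChange K).Δ)
    {c : K ≃ₐ[ℚ] K} (hc : c ≠ 1) {M : ℕ} (hM : 1 ≤ M) {z : absoluteGaloisGroup K}
    (hzfix : ∀ T : geomTorsion (W.baseChange K) ((2 : ℕ) : ℤ), z • T = T → T = 0)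
    (hcomm : ∀ π ∈ torsionFixing (W.baseChange K) ((2 : ℕ) : ℤ),
      ∀ T : geomTorsion (W.baseChange K) ((2 ^ M : ℕ) : ℤ), π • z • T = z • π • T)
    {a : ℕ} (ha : a < M)
    (hy : ∀ Q : (W.baseChange K).toAffine.Point, ((2 ^ M : ℕ) : ℤ) • Q ≠ ((((2 : ℕ) : ℤ) ^ a)) • P)
    {ε : ℤ} (hε : ε = 1 ∨ ε = -1)
    (hPε : IsOfFinAddOrder (Affine.Point.map (W' := W) (c : K →ₐ[ℚ] K) P - ε • P))
    (D : Rank1Residual.P2.KolyvaginMachine.PointSystemFamily N W K P 2 fun _ ↦ True)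
    (R : Rank1Residual.P2.KolyvaginMachine.ReciprocityFamily N W K 2 fun _ ↦ True) :
    ∀ s ∈ selmerGroup (W.baseChange K) ((2 ^ M : ℕ) : ℤ),
      (((2 : ℕ) : ℤ) ^ (M - a)) • (s - ε • conjAct W c ((2 ^ M : ℕ) : ℤ) s) = 0 := by
  haveI : IsTotallyComplex K := hK.2
  intro s hs
  have hν : (-ε) = 1 ∨ (-ε) = -1 := by rcases hε with rfl | rfl <;> simp
  have hPν := not_isOfFinAddOrder_map_sub_neg_smul W hnt c hε hPε
  haveI : Algebra.IsQuadraticExtension ℚ K := ⟨hK.1⟩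
  have hcard : Nat.card (K ≃ₐ[ℚ] K) = 2 := by rw [IsGalois.card_aut_eq_finrank, hK.1]
  have hcc : c * c = 1 := by
    have h := pow_card_eq_one' (G := K ≃ₐ[ℚ] K) (x := c)
    rwa [hcard, pow_two] at h
  have hεε : ε * ε = 1 := by rcases hε with rfl | rfl <;> norm_num
  -- `t = s − ε c_* s` is Selmer with `c_* t = −ε t`
  set t := s - ε • conjAct W c ((2 ^ M : ℕ) : ℤ) s with ht
  have htS : t ∈ selmerGroup (W.baseChange K) ((2 ^ M : ℕ) : ℤ) :=
    sub_mem hs (AddSubgroup.zsmul_mem _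
      (conjAct_mem_selmerGroup W (fun w ↦ IsTotallyComplex.isComplex w) c _ hs) ε)
  have htν : conjAct W c ((2 ^ M : ℕ) : ℤ) t = (-ε) • t := by
    rw [ht, map_sub, map_zsmul, conjAct_conjAct_of_mul_self W hcc, zsmul_sub, smul_smul, neg_mul, hεε,
      neg_one_zsmul, neg_zsmul]
    abel
  exact two_pow_smul_selmer_minus_eq_zero_of_families_two_pow W hK hP hρ hΔ hΔK hc hM hzfix hcomm ha hy
    hν hPν D R t htS htν

/-- **The `(−ε)`-part descent ON THE HABITAT H₂** (`HasCM`, `CMInert W 2`, `ρ̄₂` onto, `K` Heegner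
for `N_E`): `Δ_E < 0` and `Δ_E ∉ K²` are automatic (p591040, p596346); ty2's data at `p = 2` and the
Cartan-type `z` remain hypotheses. [cite: GrossLMS1991, Prop. 2.1 with §10 (proof)]
[cite: McCallumLMS1991, §2 Prop. 2.2, §5 Lemma 5.3] -/
theorem two_pow_smul_selmer_minus_eq_zero_of_families_of_cmInert_two_of_heegner {N : ℕ} [NeZero N]
    [W.IsElliptic] [W.IsGloballyMinimal] (hCM : W.HasCM)
    (hin : Literature.NumberTheory.EllipticCurves.Rank1Residual.CMInert W 2)
    (hρ : W.HasSurjectiveModNGaloisRep 2) (hK : IsImaginaryQuadratic K)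
    (hH : SatisfiesHeegnerHypothesis (W.conductorNorm ℤ) K)
    {P : (W.baseChange K).toAffine.Point} (hP : IsHeegnerPoint N W K P)
    {c : K ≃ₐ[ℚ] K} (hc : c ≠ 1) {M : ℕ} (hM : 1 ≤ M) {z : absoluteGaloisGroup K}
    (hzfix : ∀ T : geomTorsion (W.baseChange K) ((2 : ℕ) : ℤ), z • T = T → T = 0)
    (hcomm : ∀ π ∈ torsionFixing (W.baseChange K) ((2 : ℕ) : ℤ),
      ∀ T : geomTorsion (W.baseChange K) ((2 ^ M : ℕ) : ℤ), π • z • T = z • π • T)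
    {a : ℕ} (ha : a < M)
    (hy : ∀ Q : (W.baseChange K).toAffine.Point, ((2 ^ M : ℕ) : ℤ) • Q ≠ ((((2 : ℕ) : ℤ) ^ a)) • P)
    {ν : ℤ} (hν : ν = 1 ∨ ν = -1)
    (hPν : ¬ IsOfFinAddOrder (Affine.Point.map (W' := W) (c : K →ₐ[ℚ] K) P - ν • P))
    (D : Rank1Residual.P2.KolyvaginMachine.PointSystemFamily N W K P 2 fun _ ↦ True)
    (R : Rank1Residual.P2.KolyvaginMachine.ReciprocityFamily N W K 2 fun _ ↦ True) :
    ∀ s ∈ selmerGroup (W.baseChange K) ((2 ^ M : ℕ) : ℤ), conjAct W c ((2 ^ M : ℕ) : ℤ) s = ν • s →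
      (((2 : ℕ) : ℤ) ^ (M - a)) • s = 0 := by
  have hΔ : W.Δ < 0 := KolyvaginEigenTwo.Δ_neg_of_cmInert_two W hCM hin hρ
  have hΔK : ¬ IsSquare (W.baseChange K).Δ := by
    have h : (W.baseChange K).Δ = algebraMap ℚ K W.Δ := by rw [baseChange, map_Δ]
    rw [h]
    exact KolyvaginImageTwo.not_isSquare_algebraMap_Δ_of_cmInert_two_of_heegner W hCM hin hρ K hK hH
  exact two_pow_smul_selmer_minus_eq_zero_of_families_two_pow W hK hP hρ hΔ hΔK hc hM hzfix hcomm ha hy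
    hν hPν D R

/-- **The `τ`-part descent at level `2^M` ON THE HABITAT H₂** (`Δ_E < 0`, `Δ_E ∉ K²` automatic).
[cite: GrossLMS1991, Prop. 2.1 with §10 (proof), §5 (5.2)] [cite: McCallumLMS1991, §5 Lemma 5.1] -/
theorem two_pow_smul_sub_conjAct_eq_zero_of_families_of_cmInert_two_of_heegner {N : ℕ} [NeZero N]
    [W.IsElliptic] [W.IsGloballyMinimal] (hCM : W.HasCM)
    (hin : Literature.NumberTheory.EllipticCurves.Rank1Residual.CMInert W 2)
    (hρ : W.HasSurjectiveModNGaloisRep 2) (hK : IsImaginaryQuadratic K)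
    (hH : SatisfiesHeegnerHypothesis (W.conductorNorm ℤ) K)
    {P : (W.baseChange K).toAffine.Point} (hP : IsHeegnerPoint N W K P) (hnt : ¬ IsOfFinAddOrder P)
    {c : K ≃ₐ[ℚ] K} (hc : c ≠ 1) {M : ℕ} (hM : 1 ≤ M) {z : absoluteGaloisGroup K}
    (hzfix : ∀ T : geomTorsion (W.baseChange K) ((2 : ℕ) : ℤ), z • T = T → T = 0)
    (hcomm : ∀ π ∈ torsionFixing (W.baseChange K) ((2 : ℕ) : ℤ),
      ∀ T : geomTorsion (W.baseChange K) ((2 ^ M : ℕ) : ℤ), π • z • T = z • π • T)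
    {a : ℕ} (ha : a < M)
    (hy : ∀ Q : (W.baseChange K).toAffine.Point, ((2 ^ M : ℕ) : ℤ) • Q ≠ ((((2 : ℕ) : ℤ) ^ a)) • P)
    {ε : ℤ} (hε : ε = 1 ∨ ε = -1)
    (hPε : IsOfFinAddOrder (Affine.Point.map (W' := W) (c : K →ₐ[ℚ] K) P - ε • P))
    (D : Rank1Residual.P2.KolyvaginMachine.PointSystemFamily N W K P 2 fun _ ↦ True)
    (R : Rank1Residual.P2.KolyvaginMachine.ReciprocityFamily N W K 2 fun _ ↦ True) :
    ∀ s ∈ selmerGroup (W.baseChange K) ((2 ^ M : ℕ) : ℤ),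
      (((2 : ℕ) : ℤ) ^ (M - a)) • (s - ε • conjAct W c ((2 ^ M : ℕ) : ℤ) s) = 0 := by
  have hΔ : W.Δ < 0 := KolyvaginEigenTwo.Δ_neg_of_cmInert_two W hCM hin hρ
  have hΔK : ¬ IsSquare (W.baseChange K).Δ := by
    have h : (W.baseChange K).Δ = algebraMap ℚ K W.Δ := by rw [baseChange, map_Δ]
    rw [h]
    exact KolyvaginImageTwo.not_isSquare_algebraMap_Δ_of_cmInert_two_of_heegner W hCM hin hρ K hK hH
  exact two_pow_smul_sub_conjAct_eq_zero_of_families_two_pow W hK hP hnt hρ hΔ hΔK hc hM hzfix hcomm ha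
    hy hε hPε D R

end Summit.BirchSwinnertonDyer.BirchSwinnertonDyer.Theorems.KolyvaginDescentTwo

end
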